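import Literature.Computability.AlgebraicComplexity.LMRDetIdealModuleProofs
import Literature.Computability.AlgebraicComplexity.LMRDetIdealModule
import Literature.Computability.AlgebraicComplexity.ApolarityAction
import Mathlib.RingTheory.PowerSeries.Inverse
import Mathlib.RingTheory.PowerSeries.Trunc
import Mathlib.Algebra.Polynomial.Div
import Mathlib.RingTheory.MvPolynomial.EulerIdentity
import HarnessLib

/-!
# Landsberg–Manivel–Ressayre's equations for `det_n`, II: the weight of the equation of the flag
# — discharge of `LMR2013_thm_1_1_2_1` (Thm. 1.1.2 (1) for every `n ≥ 3`)

Topic `Computability/AlgebraicComplexity` (geometric complexity theory). Third file of the group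
`LMRDetIdealModule.lean` (the named fact `LMR2013_thm_1_1_2_1`: for every `n ≥ 3` a nonzero
highest-weight vector of weight `λ(n)^*`, `λ(n) = (2n³−4n²+1, 2n²−4n+1, 2^{2n−1}) ⊢ n·2n(n−1)`, of
`ℂ[Sym^n(ℂ^{n×n})]` lies in the ideal of `GL_{n²}·det_n`) and `LMRDetIdealModuleProofs.lean`
(LMR §2.1–2.3, §3.1 formalised: the equation `E_f = R̂_M(P_L(1,Y), det(H_P|_F)_L(1,Y))` of a
coordinate flag `f`, its vanishing on the orbit of `det_n`, its degree `2n(n−1)`, its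
non-vanishing). Cell `pub-gct-max` (track T); honest framing of that cell: multiplicity data and
certified bounds at small parameters — nothing here is a claim on VP ≠ VNP or P ≠ NP.

**What this file proves.** `LMR2013_thm_1_1_2_1_holds : LMR2013_thm_1_1_2_1` — the fact of
`LMRDetIdealModule.lean` becomes a theorem (net debt `−1`); with it every consequence proved there
from `(h : LMR2013_thm_1_1_2_1)` is unconditional (`q_det(λ(n)) ≥ 1`, `mult < a` at `λ(n)^*`, the
first-row ray `(2n³−4n²+1+nj, 2n²−4n+1, 2^{2n−1}) @ 2n(n−1)+j`, the certificate shapes, and — via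
`LMR2013_thm_1_1_2_1.detThree_idealHwv` — the `n = 3` instance `LMR2013_detThree_idealHwv` of
`LMRDetThreeIdealModule.lean`, whose own `_holds` is deliberately NOT declared here: cell `pub-gct`
owns that record). The highest-weight vector is EXPLICIT: `lmrEqCoord (lmrFlag n hn) (lmrDegM n) n`,
LMR's equation of the flag `D ⊂ L ⊂ F` spanned by the `1`, `2`, `2n+1` GREATEST matrix coordinates
(`lmrEqCoord_lmrFlag_mem_highestWeightSpace`).

**The printed argument (LMR 2013 §2.2–2.3, pp. 472–474) and how it is formalised.** LMR: "up to
scale, the coefficient `R_{L,d−1}` of `x^{d−1}` only depends on the choice of the coordinate `y`.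
That is, the condition `R_{L,d−1} = 0` … only depends on the choice of `L` and of the line `D` in
`L`", "if `F` contains `L` we get an equation depending only on the partial flag `D ⊂ L ⊂ F`. This
equation must therefore be a highest weight vector in some module of polynomials on `S^n W^*`, and
its highest weight must be of the form `aω_1 + bω_2 + cω_{k+3}`", and the weight is read off from the
rescalings (3) `R̂(αQ(x,λy), βP(x,λy)) = αβ^{e−d+1}λ^{e−d+1}R̂(Q,P)`, (4) `(T.P)(x,y,0,0) =
t_x^{−n}P(x, t_x t_y^{−1} y, 0, 0)`, (5) `det(H_{T.P}|_F)(x,y,0,0) = t_x^{−2}t_y^{−2}t_z^{−2(k+1)}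
t_x^{−e} det(H_P|_F)(x, t_x t_y^{−1}y, 0, 0)`: exponent vector `(2+e+(d−1)(e−d+1), e−d+3, 2^{(k+1)})
= (a+b+c, b+c, c^{(k+1)})`, `a = (d−1)(d−2)(k+2)`, `b = d(k+2)−2k−5`, `c = 2`; at `k = 2n−2`,
`d = n`: `λ(n) = (2n³−4n²+1, 2n²−4n+1, 2^{2n−1})`.  Here, with the tree's conventions
(`coordRep`: `(g·F)(h) = F(h ∘ (g⁻¹)ᵀ)`; `highestWeightSpace` = semi-invariants of the UPPER
triangular Borel; `partitionWeightLex n λ = λ^*` read through `revMatIdx`,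
`neg_partitionWeightLex_revMatIdx`), for `g` upper-triangular and `B = g⁻¹`:
* §13 (`hessPoly_linSubst`, `hessGenMinor_linSubst`, `hessGenMinor_mul_mul`,
  `selMatrix_mul_eq_submatrix_mul`): `H_{h∘Bᵀ} = B (H_h∘Bᵀ) Bᵀ`, and since `B` maps the span `F`
  of the flag coordinates into itself (§15: the flag is an upper set of `MatIdx n`),
  `det(H_{h∘Bᵀ}|_F) = det(B|_F)² · det(H_h|_F) ∘ Bᵀ` — eq. (5) for the full Borel, not only the
  torus;
* §14 (`lineRestr_single_eq_lmrTwist`): `(h ∘ Bᵀ)_L(1, Y) = Tw_N(h_L(1, Y))` where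
  `Tw_N r = Σ_j r_j (βY)^j (α + γY)^{N−j}` (§12, `lmrTwist`), `α = B_{xx}`, `β = B_{yy}`,
  `γ = B_{yx}` — eq. (4) together with the shear `x ↦ x + (γ/α) y` fixing `D`;
* §11–§12 (`lmrR_eq_of_eq_mul_add`, `exists_eq_mul_add_X_pow_mul`, `lmrR_lmrTwist`): the TWIST
  IDENTITY `R̂_M(Tw_d p, Tw_e q) = α^{dM+d−1} β^M R̂_M(p, q)` for `p(0) ≠ 0` — LMR's "only depends on
  the choice of `y`" made quantitative: twist a division by ascending powers
  `q = pD + Y^M R` (power series over the field, `PowerSeries.trunc`) into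
  `Tw q = Tw p · Tw D + Y^M β^M Tw R` and read off `R̂ = p(0)^M R(0)` on both sides (eq. (3) is the
  diagonal case `γ = 0`);
* §16 (`lmrEq_linSubst_of_blockTriangular`): hence `E_f(h ∘ Bᵀ) = det(B|_F)² α^{nM+n−1} β^M E_f(h)`
  whenever `h(e_x) ≠ 0`;
* §17 (`weightChar_lmrPartition`): `χ_{λ(n)^*}(g) = det(B|_F)² α^{nM+n−1} β^M` (the exponent
  bookkeeping `λ₁ = nM+n+1`, `λ₂ = M+2`, `λ_{3..2n+1} = 2`, `M = 2n²−4n−1`;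
  `sortedParts_lmrPartition`);
* §18: the two polynomial functions `g·E_f` and `χ(g) E_f` on `Sym^n` agree on the dense set
  `{h(e_x) ≠ 0}`, hence `(g·E_f − χ(g)E_f) · X_{x^n} = 0` identically (`MvPolynomial.funext`) and
  `g·E_f = χ(g) E_f`; with `E_f ≠ 0` (test form of the proofs file) and `E_f ∈ I(GL·det_n)` this is
  `LMR2013_thm_1_1_2_1_holds`.

No named facts (net debt `−1`: one fact discharged, none introduced); definitions with bodies only
(`lmrTwist`).

## References
* [LandsbergManivelRessayre2013] J. M. Landsberg, L. Manivel, N. Ressayre, *Hypersurfaces with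
  degenerate duals and the geometric complexity theory program*, Comment. Math. Helv. 88 (2013)
  469–484: §2.2 eqs. (1)–(3), §2.3 eqs. (4)–(5) and Thm. 2.3.1 (pp. 472–474), §3.1–3.2 (pp. 475–476),
  Thm. 1.1.2 (1) (p. 470) `[corpus:paper:galaxy-pdf-8572435590081880720 p0004–p0008]`.

## Mathlib and tree
Tree: everything of `LMRDetIdealModuleProofs.lean` (`lmrR`, `lmrS`, `lmrEq`, `lmrEqCoord`,
`lmrDegM`, `lmrFlag`, `planeRestr`, `selMatrix`, `planeRestr_monomial`, `lmrR_eq_zero_of_eq_mul`,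
`lmrEq_eq_zero_of_mem_glOrbit_detFormLex`, `lmrEq_lmrWitness_ne_zero`, `aeval_formCoeff_lmrEqCoord`,
`eval_lmrEqCoord`, …); `lmrPartition`, `lmrPartition_parts`, `LMR2013_thm_1_1_2_1`
(`LMRDetIdealModule.lean`); `pderiv_linSubst_eq_sum` (`ApolarityAction.lean`); `linSubst_X`,
`linSubst_C`, `linSubst_isHomogeneous`, `linSubstRep_apply` (`LinSubst.lean`); `coordRep_apply`,
`coordSubst`, `aeval_formCoeff_coordSubst`, `formCoeff` (`OrbitCoordinateRing.lean`);
`highestWeightSpace`, `mem_highestWeightSpace_iff`, `weightChar`, `weightChar_mul`, `IsUpperTriangular`,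
`borelSubgroup` (`GLHighestWeight.lean`); `revMatIdx`, `neg_partitionWeightLex_revMatIdx`
(`PlethysmStabilityBIP.lean`); `formCoeff_sum_monomial`, `isHomogeneous_sum_monomial`
(`SchurWeylPlethysmCoordRepWeightsProofs.lean`); `Nat.Partition.sortedParts`. Mathlib:
`PowerSeries.trunc`, `PowerSeries.mul_inv_cancel`, `PowerSeries.X_pow_dvd_iff`, `Polynomial.X_pow_dvd_iff`,
`Matrix.det_of_lowerTriangular`, `Matrix.BlockTriangular`, `Matrix.single_one_vecMul`,
`MvPolynomial.IsHomogeneous.pderiv`, `MvPolynomial.funext`, `List.mergeSort_eq_self`.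
-/

noncomputable section

open MvPolynomial Matrix Polynomial

namespace Literature.Computability.AlgebraicComplexity

/-! Section numbers continue those of `LMRDetIdealModuleProofs.lean` (§1–§10). -/

/-! ### §11 Division by ascending powers and the value of `R̂` -/

section Ascending

variable {A : Type*} [CommRing A]

/-- `R̂` is additive in `q`. [cite: LandsbergManivelRessayre2013, §2.2, eq. (2) ("linear in the
coefficients of `Q_L`")] -/
theorem lmrR_add_right (M : ℕ) (p q q' : A[X]) :
    lmrR M p (q + q') = lmrR M p q + lmrR M p q' := by
  rw [lmrR, lmrR, lmrR, add_mul, Polynomial.coeff_add]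

/-- The constant coefficient of `S_M(p)` is `p(0)^M`. [cite: LandsbergManivelRessayre2013, §2.2] -/
theorem coeff_zero_lmrS (M : ℕ) (p : A[X]) : (lmrS M p).coeff 0 = p.coeff 0 ^ M := by
  rw [lmrS, Polynomial.finsetSum_coeff, Finset.sum_eq_single 0]
  · rw [pow_zero, one_mul, show M + 1 - 1 - 0 = M by omega, ← Polynomial.C_pow,
      Polynomial.coeff_C_zero]
  · intro i _ hi
    have hX : (Polynomial.X : A[X]) ∣
        (-(p - Polynomial.C (p.coeff 0))) ^ i * Polynomial.C (p.coeff 0) ^ (M + 1 - 1 - i) := by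
      refine Dvd.dvd.mul_right (dvd_pow ?_ hi) _
      rw [Polynomial.X_dvd_iff]
      simp
    exact Polynomial.X_dvd_iff.mp hX
  · intro h
    exact absurd (Finset.mem_range.mpr (Nat.succ_pos M)) h

/-- **Value of `R̂` from a division by ascending powers** (LMR eq. (1) dehomogenised at `x = 1`:
`Q_L = P_L D_L + y^{e−d+1} R_L`): if `q = p·D + Y^M·R` with `deg D < M` then
`R̂_M(p, q) = p(0)^M · R(0)` (`R(0) = R_{L,d−1}`). [cite: LandsbergManivelRessayre2013, §2.2,
eqs. (1)–(2) ("`R_{L,d−1}/p_d` is equal to the coefficient of `y^{e−d+1}` in `Q_L(1,y)/P_L(1,y)`")] -/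
theorem lmrR_eq_of_eq_mul_add (M : ℕ) {p q D R : A[X]} (h : q = p * D + Polynomial.X ^ M * R)
    (hD : D.natDegree < M) : lmrR M p q = p.coeff 0 ^ M * R.coeff 0 := by
  rw [h, lmrR_add_right, lmrR_eq_zero_of_eq_mul M rfl hD, zero_add, lmrR, mul_assoc,
    Polynomial.coeff_X_pow_mul', if_pos le_rfl, Nat.sub_self, Polynomial.mul_coeff_zero,
    coeff_zero_lmrS, mul_comm]

/-- **Division by ascending powers of `y`** (LMR: "set `x = 1` … an identity between power series in
`y`, to which `D_L` contributes only up to degree `e − d`"): over a field, if `p(0) ≠ 0` then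
`q = p·D + Y^M·R` with `deg D < M`. [cite: LandsbergManivelRessayre2013, §2.2, eq. (1)] -/
theorem exists_eq_mul_add_X_pow_mul {K : Type*} [Field K] (M : ℕ) (p q : K[X])
    (hp : p.coeff 0 ≠ 0) :
    ∃ D R : K[X], q = p * D + Polynomial.X ^ M * R ∧ (D = 0 ∨ D.natDegree < M) := by
  set φ : PowerSeries K := (q : PowerSeries K) * (p : PowerSeries K)⁻¹ with hφ
  have hp' : PowerSeries.constantCoeff (p : PowerSeries K) ≠ 0 := by
    rwa [Polynomial.constantCoeff_coe]
  obtain ⟨ψ, hψ⟩ : (PowerSeries.X : PowerSeries K) ^ M ∣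
      φ - (PowerSeries.trunc M φ : K[X]) := by
    rw [PowerSeries.X_pow_dvd_iff]
    intro m hm
    rw [map_sub, Polynomial.coeff_coe, PowerSeries.coeff_trunc, if_pos hm, sub_self]
  have htr : ((PowerSeries.trunc M φ : K[X]) : PowerSeries K) = φ - PowerSeries.X ^ M * ψ := by
    rw [← hψ]
    ring
  have hmul : ((p * PowerSeries.trunc M φ : K[X]) : PowerSeries K) =
      (q : PowerSeries K) - PowerSeries.X ^ M * ((p : PowerSeries K) * ψ) := by
    rw [Polynomial.coe_mul, htr, mul_sub, hφ, mul_comm (q : PowerSeries K), ← mul_assoc,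
      PowerSeries.mul_inv_cancel _ hp', one_mul]
    ring
  have hdvd : (Polynomial.X : K[X]) ^ M ∣ q - p * PowerSeries.trunc M φ := by
    rw [Polynomial.X_pow_dvd_iff]
    intro d hd
    rw [Polynomial.coeff_sub, sub_eq_zero, ← Polynomial.coeff_coe, ← Polynomial.coeff_coe, hmul,
      map_sub, PowerSeries.coeff_X_pow_mul', if_neg (not_le.mpr hd), sub_zero]
  obtain ⟨R, hR⟩ := hdvd
  refine ⟨PowerSeries.trunc M φ, R, by rw [← hR]; ring, ?_⟩
  by_cases h0 : PowerSeries.trunc M φ = 0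
  · exact Or.inl h0
  · right
    rw [Polynomial.natDegree_lt_iff_degree_lt h0]
    exact PowerSeries.degree_trunc_lt φ M

end Ascending

/-! ### §12 The twist `F(x, y) ↦ F(αx + γy, βy)` on dehomogenised binary forms (`lmrTwist`) -/

section Twist

variable {A : Type*} [CommRing A]

/-- The twist of a dehomogenised binary form: if `r(Y) = F(1, Y)` for a binary form `F` of degree
`N`, then `lmrTwist N α β γ r = F(α + γ Y, β Y) = Σ_j r_j (βY)^j (α + γY)^{N−j}` — the effect on
`P_L(1, y)` of the change of adapted coordinates `x ↦ αx + γy`, `y ↦ βy` on `L` fixing the line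
`D = {y = 0}`. [cite: LandsbergManivelRessayre2013, §2.2 ("up to scale, the coefficient `R_{L,d−1}`
of `x^{d−1}` only depends on the choice of the coordinate `y`") and §2.3, eq. (4)] -/
def lmrTwist (N : ℕ) (α β γ : A) (r : A[X]) : A[X] :=
  ∑ j ∈ Finset.range (N + 1),
    Polynomial.C (r.coeff j) * (Polynomial.C β * Polynomial.X) ^ j * (Polynomial.C α + Polynomial.C γ * Polynomial.X) ^ (N - j)

/-- Twist of a monomial. [cite: LandsbergManivelRessayre2013, §2.3, eq. (4)] -/
theorem lmrTwist_C_mul_X_pow {N m : ℕ} (hm : m ≤ N) (α β γ c : A) :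
    lmrTwist N α β γ (Polynomial.C c * Polynomial.X ^ m) =
      Polynomial.C c * (Polynomial.C β * Polynomial.X) ^ m * (Polynomial.C α + Polynomial.C γ * Polynomial.X) ^ (N - m) := by
  rw [lmrTwist, Finset.sum_eq_single m]
  · rw [Polynomial.coeff_C_mul_X_pow, if_pos rfl]
  · intro j _ hj
    rw [Polynomial.coeff_C_mul_X_pow, if_neg hj, map_zero, zero_mul, zero_mul]
  · intro h
    exact absurd (Finset.mem_range.mpr (Nat.lt_succ_of_le hm)) h

/-- The twist of `Y^M` in degree `M` is `(βY)^M`. [cite: LandsbergManivelRessayre2013, §2.3, eq. (4)] -/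
theorem lmrTwist_X_pow_self (M : ℕ) (α β γ : A) :
    lmrTwist M α β γ (Polynomial.X ^ M) = (Polynomial.C β * Polynomial.X) ^ M := by
  have := lmrTwist_C_mul_X_pow (le_refl M) α β γ 1
  rwa [map_one, one_mul, one_mul, Nat.sub_self, pow_zero, mul_one] at this

/-- The twist is additive. [cite: LandsbergManivelRessayre2013, §2.2, eq. (2)] -/
theorem lmrTwist_add (N : ℕ) (α β γ : A) (r s : A[X]) :
    lmrTwist N α β γ (r + s) = lmrTwist N α β γ r + lmrTwist N α β γ s := by
  simp only [lmrTwist, Polynomial.coeff_add, map_add, add_mul, Finset.sum_add_distrib]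

/-- The twist of `0`. [cite: LandsbergManivelRessayre2013, §2.2] -/
theorem lmrTwist_zero (N : ℕ) (α β γ : A) : lmrTwist N α β γ 0 = 0 := by
  simp [lmrTwist]

/-- The twist commutes with finite sums. [cite: LandsbergManivelRessayre2013, §2.2] -/
theorem lmrTwist_sum {ι' : Type*} (s : Finset ι') (N : ℕ) (α β γ : A) (g : ι' → A[X]) :
    lmrTwist N α β γ (∑ i ∈ s, g i) = ∑ i ∈ s, lmrTwist N α β γ (g i) := by
  classical
  induction s using Finset.induction_on with
  | empty => rw [Finset.sum_empty, Finset.sum_empty, lmrTwist_zero]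
  | insert a s ha ih => rw [Finset.sum_insert ha, Finset.sum_insert ha, lmrTwist_add, ih]

/-- **The twist is multiplicative**: `Tw_{a+b}(r s) = Tw_a(r) · Tw_b(s)` for `deg r ≤ a`,
`deg s ≤ b` (homogenisation is multiplicative). [cite: LandsbergManivelRessayre2013, §2.2, eq. (1)] -/
theorem lmrTwist_mul {a b : ℕ} (α β γ : A) {r s : A[X]} (hr : r.natDegree ≤ a)
    (hs : s.natDegree ≤ b) :
    lmrTwist (a + b) α β γ (r * s) = lmrTwist a α β γ r * lmrTwist b α β γ s := by
  have hr' := r.as_sum_range_C_mul_X_pow' (Nat.lt_succ_of_le hr)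
  have hs' := s.as_sum_range_C_mul_X_pow' (Nat.lt_succ_of_le hs)
  rw [hr', hs']
  simp only [Finset.sum_mul_sum, lmrTwist_sum]
  refine Finset.sum_congr rfl fun i hi => Finset.sum_congr rfl fun j hj => ?_
  have hi' : i ≤ a := Nat.lt_succ_iff.mp (Finset.mem_range.mp hi)
  have hj' : j ≤ b := Nat.lt_succ_iff.mp (Finset.mem_range.mp hj)
  have hmul : Polynomial.C (r.coeff i) * Polynomial.X ^ i * (Polynomial.C (s.coeff j) * Polynomial.X ^ j) =
      Polynomial.C (r.coeff i * s.coeff j) * Polynomial.X ^ (i + j) := by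
    rw [map_mul, pow_add]
    ring
  rw [hmul, lmrTwist_C_mul_X_pow (by omega), lmrTwist_C_mul_X_pow hi', lmrTwist_C_mul_X_pow hj',
    show a + b - (i + j) = (a - i) + (b - j) by omega, pow_add, map_mul]
  ring

/-- The constant term of a twist: `Tw_N(r)(0) = r(0) α^N`. [cite: LandsbergManivelRessayre2013,
§2.3, eq. (4)] -/
theorem coeff_zero_lmrTwist (N : ℕ) (α β γ : A) (r : A[X]) :
    (lmrTwist N α β γ r).coeff 0 = r.coeff 0 * α ^ N := by
  rw [Polynomial.coeff_zero_eq_eval_zero, lmrTwist, Polynomial.eval_finsetSum,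
    Finset.sum_eq_single 0]
  · simp
  · intro j _ hj
    simp [zero_pow hj]
  · intro h
    exact absurd (Finset.mem_range.mpr (Nat.succ_pos N)) h

/-- A twist in degree `N` has degree at most `N`. [cite: LandsbergManivelRessayre2013, §2.2] -/
theorem natDegree_lmrTwist_le (N : ℕ) (α β γ : A) (r : A[X]) :
    (lmrTwist N α β γ r).natDegree ≤ N := by
  unfold lmrTwist
  refine Polynomial.natDegree_sum_le_of_forall_le _ _ fun j hj => ?_
  have hj' : j ≤ N := Nat.lt_succ_iff.mp (Finset.mem_range.mp hj)
  have h1 : (Polynomial.C β * Polynomial.X : A[X]).natDegree ≤ 1 :=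
    (Polynomial.natDegree_C_mul_le _ _).trans Polynomial.natDegree_X_le
  have h2 : (Polynomial.C α + Polynomial.C γ * Polynomial.X : A[X]).natDegree ≤ 1 :=
    (Polynomial.natDegree_add_le _ _).trans (max_le (by simp)
      ((Polynomial.natDegree_C_mul_le _ _).trans Polynomial.natDegree_X_le))
  have ht : (Polynomial.C (r.coeff j) * (Polynomial.C β * Polynomial.X) ^ j *
      (Polynomial.C α + Polynomial.C γ * Polynomial.X) ^ (N - j)).natDegree ≤ (0 + j * 1) + (N - j) * 1 :=
    Polynomial.natDegree_mul_le_of_le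
      (Polynomial.natDegree_mul_le_of_le (Polynomial.natDegree_C _).le
        (Polynomial.natDegree_pow_le_of_le j h1))
      (Polynomial.natDegree_pow_le_of_le (N - j) h2)
  omega

/-- **The twist identity for `R̂`** (LMR: "up to scale, the coefficient `R_{L,d−1}` of `x^{d−1}`
only depends on the choice of the coordinate `y`", with the scale computed as in eqs. (3)–(5)):
for `deg p ≤ d`, `deg q ≤ e = M + d − 1`, `p(0) ≠ 0` (over a field),
`R̂_M(Tw_d p, Tw_e q) = α^{dM + d − 1} β^M R̂_M(p, q)`. Proof: lmrTwist a division by ascending powers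
`q = pD + Y^M R` into `Tw q = Tw p · Tw D + Y^M β^M Tw R` and read off `R̂ = p(0)^M R(0)` on both
sides. [cite: LandsbergManivelRessayre2013, §2.2 eqs. (1)–(3) and §2.3 eqs. (4)–(5)] -/
theorem lmrR_lmrTwist {K : Type*} [Field K] {M d : ℕ} (hM : 1 ≤ M) (hd : 1 ≤ d) {p q : K[X]}
    (hp : p.natDegree ≤ d) (hq : q.natDegree ≤ M + d - 1) (hp0 : p.coeff 0 ≠ 0) (α β γ : K) :
    lmrR M (lmrTwist d α β γ p) (lmrTwist (M + d - 1) α β γ q) =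
      α ^ (d * M + (d - 1)) * β ^ M * lmrR M p q := by
  obtain ⟨D, R, hqd, hD⟩ := exists_eq_mul_add_X_pow_mul M p q hp0
  have hDdeg : D.natDegree < M := by
    rcases hD with h | h
    · rw [h, Polynomial.natDegree_zero]; omega
    · exact h
  have hRdeg : R.natDegree ≤ d - 1 := by
    by_cases hR0 : R = 0
    · rw [hR0, Polynomial.natDegree_zero]; exact Nat.zero_le _
    have hXR : (Polynomial.X ^ M * R).natDegree = M + R.natDegree := by
      rw [Polynomial.natDegree_mul (pow_ne_zero _ Polynomial.X_ne_zero) hR0,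
        Polynomial.natDegree_X_pow]
    have h1 : (Polynomial.X ^ M * R).natDegree ≤ M + d - 1 := by
      have : Polynomial.X ^ M * R = q - p * D := by rw [hqd]; ring
      rw [this]
      refine (Polynomial.natDegree_sub_le _ _).trans (max_le hq ?_)
      exact Polynomial.natDegree_mul_le.trans (by omega)
    omega
  have e1 : lmrR M p q = p.coeff 0 ^ M * R.coeff 0 := lmrR_eq_of_eq_mul_add M hqd hDdeg
  have hq' : lmrTwist (M + d - 1) α β γ q =
      lmrTwist d α β γ p * lmrTwist (M - 1) α β γ D +
        Polynomial.X ^ M * (Polynomial.C (β ^ M) * lmrTwist (d - 1) α β γ R) := by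
    rw [hqd, lmrTwist_add, show M + d - 1 = d + (M - 1) by omega, lmrTwist_mul α β γ hp (by omega),
      show d + (M - 1) = M + (d - 1) by omega,
      lmrTwist_mul α β γ (Polynomial.natDegree_X_pow_le M) hRdeg, lmrTwist_X_pow_self, mul_pow,
      Polynomial.C_pow]
    ring
  have e2 : lmrR M (lmrTwist d α β γ p) (lmrTwist (M + d - 1) α β γ q) =
      (lmrTwist d α β γ p).coeff 0 ^ M * (Polynomial.C (β ^ M) * lmrTwist (d - 1) α β γ R).coeff 0 :=
    lmrR_eq_of_eq_mul_add M hq' ((natDegree_lmrTwist_le _ _ _ _ _).trans_lt (by omega))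
  rw [e2, e1, coeff_zero_lmrTwist, Polynomial.coeff_C_mul, coeff_zero_lmrTwist]
  ring

end Twist


/-! ### §13 Hessians and plane restrictions under linear substitutions -/

section ChainRule

variable {A : Type*} [CommRing A] {ι : Type*} [Fintype ι] [DecidableEq ι] {r : ℕ}

omit [DecidableEq ι] in
/-- Scalar matrices (entries `C a`) are fixed entrywise by a linear substitution.
[cite: LandsbergManivelRessayre2013, §2.3, eq. (5)] -/
theorem map_C_map_linSubst {m n' : Type*} (M : Matrix ι ι A) (N : Matrix m n' A) :
    (N.map (MvPolynomial.C : A →+* MvPolynomial ι A)).map (linSubst ι A M) =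
      N.map (MvPolynomial.C : A →+* MvPolynomial ι A) := by
  ext a b
  simp only [Matrix.map_apply, linSubst_C]

omit [DecidableEq ι] in
/-- **Hessian chain rule**: `H_{P ∘ Mᵀ} = M · (H_P ∘ Mᵀ) · Mᵀ` for the linear substitution
`X i ↦ Σ_j M j i X j` (LMR: "the matrix of `H_{T.P}|_F` is obtained from that of `H_P|_F` by
substituting … and multiplying the rows and columns"). [cite: LandsbergManivelRessayre2013, §2.3, eq. (5)] -/
theorem hessPoly_linSubst (M : Matrix ι ι A) (P : MvPolynomial ι A) :
    hessPoly (linSubst ι A M P) =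
      M.map (MvPolynomial.C : A →+* MvPolynomial ι A) * (hessPoly P).map (linSubst ι A M) *
        (M.map (MvPolynomial.C : A →+* MvPolynomial ι A))ᵀ := by
  refine Matrix.ext fun a b => ?_
  rw [hessPoly_apply, pderiv_linSubst_eq_sum, map_sum (pderiv (R := A) a)]
  simp only [Derivation.map_smul, pderiv_linSubst_eq_sum, Finset.smul_sum, smul_smul]
  simp only [Matrix.mul_apply, Matrix.transpose_apply, Matrix.map_apply, hessPoly_apply,
    MvPolynomial.smul_eq_C_mul, Finset.sum_mul]
  refine Finset.sum_congr rfl fun j _ => Finset.sum_congr rfl fun i _ => ?_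
  rw [map_mul]
  ring

omit [DecidableEq ι] in
/-- The generalised Hessian minor of a substituted polynomial: `det(U H_{P∘Mᵀ} Vᵀ) =
(det((UM) H_P (VM)ᵀ)) ∘ Mᵀ`. [cite: LandsbergManivelRessayre2013, §2.3, eq. (5)] -/
theorem hessGenMinor_linSubst (M : Matrix ι ι A) (U V : Matrix (Fin r) ι A)
    (P : MvPolynomial ι A) :
    hessGenMinor U V (linSubst ι A M P) = linSubst ι A M (hessGenMinor (U * M) (V * M) P) := by
  rw [hessGenMinor, hessGenMinor, hessPoly_linSubst, AlgHom.map_det, AlgHom.mapMatrix_apply]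
  simp only [Matrix.map_mul, Matrix.transpose_map, map_C_map_linSubst, Matrix.transpose_mul,
    Matrix.mul_assoc]

omit [DecidableEq ι] in
/-- Multiplying the row matrices by square scalar matrices rescales the generalised minor by
their determinants. [cite: LandsbergManivelRessayre2013, §2.3, eq. (5) (the factor `t_x^{−2}t_y^{−2}t_z^{−2(k+1)}`)] -/
theorem hessGenMinor_mul_mul {m : ℕ} (N N' : Matrix (Fin m) (Fin m) A) (U V : Matrix (Fin m) ι A)
    (P : MvPolynomial ι A) :
    hessGenMinor (N * U) (N' * V) P = MvPolynomial.C (N.det * N'.det) * hessGenMinor U V P := by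
  set C' : A →+* MvPolynomial ι A := MvPolynomial.C with hC'
  rw [hessGenMinor, hessGenMinor, Matrix.map_mul, Matrix.map_mul, Matrix.transpose_mul]
  have hassoc : N.map C' * U.map C' * hessPoly P * ((V.map C')ᵀ * (N'.map C')ᵀ) =
      N.map C' * (U.map C' * hessPoly P * (V.map C')ᵀ) * (N'.map C')ᵀ := by
    simp only [Matrix.mul_assoc]
  rw [hassoc, Matrix.det_mul, Matrix.det_mul, Matrix.det_transpose, ← RingHom.mapMatrix_apply,
    ← RingHom.mapMatrix_apply, ← RingHom.map_det, ← RingHom.map_det, map_mul]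
  ring

/-- If the rows of `B` indexed by the flag are supported on the flag, the selection matrix
intertwines `B` with its flag block: `S_f · B = B|_{f×f} · S_f`. [cite: LandsbergManivelRessayre2013, §2.3 (`H_P|_F`
for a flag-adapted basis)] -/
theorem selMatrix_mul_eq_submatrix_mul (f : Fin r → ι) (hf : Function.Injective f)
    (B : Matrix ι ι A) (hB : ∀ a j, B (f a) j ≠ 0 → j ∈ Set.range f) :
    selMatrix (A := A) f * B = B.submatrix f f * selMatrix (A := A) f := by
  ext a j
  rw [Matrix.mul_apply, Matrix.mul_apply]
  have hL : ∑ i, selMatrix (A := A) f a i * B i j = B (f a) j := by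
    simp [selMatrix, Matrix.of_apply, ite_mul]
  rw [hL]
  simp only [Matrix.submatrix_apply, selMatrix, Matrix.of_apply, mul_ite, mul_one, mul_zero]
  by_cases hj : j ∈ Set.range f
  · obtain ⟨b, rfl⟩ := hj
    rw [Finset.sum_eq_single b]
    · rw [if_pos rfl]
    · intro b' _ hb'
      rw [if_neg fun h => hb' (hf h).symm]
    · intro h
      exact absurd (Finset.mem_univ b) h
  · rw [Finset.sum_eq_zero fun b _ => if_neg fun h => hj ⟨b, h.symm⟩]
    by_contra h
    exact hj (hB a j h)

omit [Fintype ι] [DecidableEq ι] in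
/-- Entries of the polynomial Hessian of a form of degree `d` are forms of degree `d − 2`.
[cite: LandsbergManivelRessayre2013, §2.1 ("a polynomial of degree `(k+3)(d−2)`")] -/
theorem isHomogeneous_hessPoly_apply {P : MvPolynomial ι A} {d : ℕ} (hP : P.IsHomogeneous d)
    (i j : ι) : (hessPoly P i j).IsHomogeneous (d - 2) := by
  rw [hessPoly_apply]
  have := (hP.pderiv (i := j)).pderiv (i := i)
  rwa [Nat.sub_sub] at this

omit [DecidableEq ι] in
/-- The generalised `m`-minor of the Hessian of a form of degree `d` is a form of degree
`m (d − 2)` (`e = (k+3)(d−2)`). [cite: LandsbergManivelRessayre2013, §2.1 + §2.3 (`e = (k+3)(d−2)`)] -/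
theorem isHomogeneous_hessGenMinor {m : ℕ} (U V : Matrix (Fin m) ι A) {P : MvPolynomial ι A}
    {d : ℕ} (hP : P.IsHomogeneous d) : (hessGenMinor U V P).IsHomogeneous (m * (d - 2)) := by
  have hentry : ∀ a c, ((U.map (MvPolynomial.C : A →+* MvPolynomial ι A) * hessPoly P *
      (V.map (MvPolynomial.C : A →+* MvPolynomial ι A))ᵀ) a c).IsHomogeneous (d - 2) := by
    intro a c
    rw [Matrix.mul_apply]
    refine IsHomogeneous.sum _ _ _ fun j _ => ?_
    rw [Matrix.transpose_apply, Matrix.map_apply, Matrix.mul_apply]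
    have : (∑ i, U.map (MvPolynomial.C : A →+* MvPolynomial ι A) a i * hessPoly P i j).IsHomogeneous
        (d - 2) := by
      refine IsHomogeneous.sum _ _ _ fun i _ => ?_
      rw [Matrix.map_apply]
      simpa using (isHomogeneous_C _ (U a i)).mul (isHomogeneous_hessPoly_apply hP i j)
    simpa using this.mul (isHomogeneous_C _ (V c j))
  rw [hessGenMinor, Matrix.det_apply]
  refine IsHomogeneous.sum _ _ _ fun σ _ => ?_
  rw [Units.smul_def, zsmul_eq_mul, ← map_intCast (MvPolynomial.C : A →+* MvPolynomial ι A)]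
  have hprod := IsHomogeneous.prod Finset.univ
    (fun a => (U.map (MvPolynomial.C : A →+* MvPolynomial ι A) * hessPoly P *
      (V.map (MvPolynomial.C : A →+* MvPolynomial ι A))ᵀ) (σ a) a) (fun _ => d - 2)
    (fun a _ => hentry (σ a) a)
  rw [Finset.sum_const, Finset.card_univ, Fintype.card_fin, smul_eq_mul] at hprod
  have := (isHomogeneous_C ι ((((Equiv.Perm.sign σ : ℤˣ) : ℤ) : A))).mul hprod
  rwa [zero_add] at this

end ChainRule

section PlaneTwist

variable {A : Type*} [CommRing A] {ι : Type*} [Fintype ι] [DecidableEq ι]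

omit [DecidableEq ι] in
/-- The restriction to a line of a substituted polynomial: `(P ∘ Mᵀ)(a + t b) = P(Mᵀa + t Mᵀb)`,
`Mᵀ a = a ᵥ* M`. [cite: LandsbergManivelRessayre2013, §2.3, eq. (4) (`(T.P)(x, y, 0, 0)`)] -/
theorem lineRestr_linSubst (M : Matrix ι ι A) (a b : ι → A) (P : MvPolynomial ι A) :
    lineRestr a b (linSubst ι A M P) = lineRestr (Matrix.vecMul a M) (Matrix.vecMul b M) P := by
  suffices h : (lineRestr a b).comp (linSubst ι A M) =
      lineRestr (Matrix.vecMul a M) (Matrix.vecMul b M) from AlgHom.congr_fun h P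
  apply MvPolynomial.algHom_ext
  intro i
  rw [AlgHom.comp_apply, linSubst_X, map_sum, lineRestr_X]
  simp only [map_smul, lineRestr_X, Matrix.vecMul, dotProduct, map_sum, Finset.sum_mul]
  rw [← Finset.sum_add_distrib]
  refine Finset.sum_congr rfl fun j _ => ?_
  rw [Polynomial.smul_eq_C_mul, map_mul, map_mul]
  ring

/-- The restriction of a monomial to the line `α e_x + t (γ e_x + β e_y)`.
[cite: LandsbergManivelRessayre2013, §2.2–2.3 (`P_L` in adapted coordinates)] -/
theorem lineRestr_single_monomial {x y : ι} (hxy : x ≠ y) (α β γ : A) (μ : ι →₀ ℕ) (c : A) :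
    lineRestr (Pi.single (M := fun _ => A) x α)
        (Pi.single (M := fun _ => A) x γ + Pi.single (M := fun _ => A) y β)
        (MvPolynomial.monomial μ c) =
      if ∀ i, i ≠ x → i ≠ y → μ i = 0 then
        Polynomial.C c * (Polynomial.C α + Polynomial.C γ * Polynomial.X) ^ (μ x) *
          (Polynomial.C β * Polynomial.X) ^ (μ y)
      else 0 := by
  classical
  set u : ι → A := Pi.single (M := fun _ => A) x α with hu
  set w : ι → A := Pi.single (M := fun _ => A) x γ + Pi.single (M := fun _ => A) y β with hw
  have hdef : lineRestr u w (MvPolynomial.monomial μ c) =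
      Polynomial.C c * μ.prod fun i e => (Polynomial.C (u i) + Polynomial.C (w i) * Polynomial.X) ^ e := by
    rw [lineRestr, MvPolynomial.aeval_monomial, Polynomial.algebraMap_eq]
  rw [hdef]
  have hgx : Polynomial.C (u x) + Polynomial.C (w x) * Polynomial.X =
      Polynomial.C α + Polynomial.C γ * Polynomial.X := by
    rw [hu, hw, Pi.add_apply, Pi.single_eq_same, Pi.single_eq_same, Pi.single_eq_of_ne hxy, add_zero]
  have hgy : Polynomial.C (u y) + Polynomial.C (w y) * Polynomial.X = Polynomial.C β * Polynomial.X := by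
    rw [hu, hw, Pi.add_apply, Pi.single_eq_same, Pi.single_eq_of_ne (Ne.symm hxy),
      Pi.single_eq_of_ne (Ne.symm hxy), map_zero, zero_add, zero_add]
  have hgz : ∀ i, i ≠ x → i ≠ y → Polynomial.C (u i) + Polynomial.C (w i) * Polynomial.X = 0 := by
    intro i hix hiy
    rw [hu, hw, Pi.add_apply, Pi.single_eq_of_ne hix, Pi.single_eq_of_ne hix,
      Pi.single_eq_of_ne hiy]
    simp
  split_ifs with hcond
  · have hsub : μ.support ⊆ {x, y} := by
      intro i hi
      rw [Finset.mem_insert, Finset.mem_singleton]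
      by_contra h
      rw [not_or] at h
      exact (Finsupp.mem_support_iff.mp hi) (hcond i h.1 h.2)
    rw [Finsupp.prod_of_support_subset μ hsub _ (fun i _ => pow_zero _), Finset.prod_pair hxy, hgx,
      hgy, mul_assoc]
  · simp only [not_forall] at hcond
    obtain ⟨i, hix, hiy, hi⟩ := hcond
    rw [Finsupp.prod, Finset.prod_eq_zero (Finsupp.mem_support_iff.mpr hi), mul_zero]
    rw [hgz i hix hiy, zero_pow hi]

end PlaneTwist



/-! ### §14 Plane restrictions of forms: linearity of `R̂`, degree, constant term, twist -/

section PlaneForms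

variable {A : Type*} [CommRing A] {ι : Type*} [Fintype ι] [DecidableEq ι]

omit [Fintype ι] [DecidableEq ι] in
/-- `R̂` is `A`-linear in `q`: constants pull out. [cite: LandsbergManivelRessayre2013, §2.2, eq. (2)] -/
theorem lmrR_C_mul_right (M : ℕ) (p q : A[X]) (c : A) :
    lmrR M p (Polynomial.C c * q) = c * lmrR M p q := by
  rw [lmrR, lmrR, mul_assoc, Polynomial.coeff_C_mul]

/-- For a form `h` of degree `N`: `h(α e_x + t(γ e_x + β e_y)) = Tw_N(h(e_x + t e_y))` — the change of
adapted coordinates on the plane `L`. [cite: LandsbergManivelRessayre2013, §2.3, eq. (4)] -/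
theorem lineRestr_single_eq_lmrTwist {x y : ι} (hxy : x ≠ y) (α β γ : A) {h : MvPolynomial ι A}
    {N : ℕ} (hh : h.IsHomogeneous N) :
    lineRestr (Pi.single (M := fun _ => A) x α)
        (Pi.single (M := fun _ => A) x γ + Pi.single (M := fun _ => A) y β) h =
      lmrTwist N α β γ (planeRestr (A := A) x y h) := by
  classical
  conv_lhs => rw [h.as_sum]
  conv_rhs => rw [h.as_sum]
  rw [map_sum, map_sum, lmrTwist_sum]
  refine Finset.sum_congr rfl fun μ hμ => ?_
  have hdeg : μ.degree = N := by
    by_contra hd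
    exact (MvPolynomial.mem_support_iff.mp hμ) (hh.coeff_eq_zero hd)
  rw [lineRestr_single_monomial hxy, planeRestr_monomial hxy]
  split_ifs with hcond
  · have hsub : μ.support ⊆ {x, y} := by
      intro i hi
      rw [Finset.mem_insert, Finset.mem_singleton]
      by_contra h'
      rw [not_or] at h'
      exact (Finsupp.mem_support_iff.mp hi) (hcond i h'.1 h'.2)
    have hxyN : μ x + μ y = N := by
      rw [← hdeg, Finsupp.degree_apply,
        Finset.sum_subset hsub (fun i _ hi => Finsupp.notMem_support_iff.mp hi),
        Finset.sum_pair hxy]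
    rw [lmrTwist_C_mul_X_pow (by omega), show N - μ y = μ x by omega]
    ring
  · rw [lmrTwist_zero]

/-- The plane restriction of a form of degree `N` has degree at most `N`.
[cite: LandsbergManivelRessayre2013, §2.2 (`P_L(1, y)`)] -/
theorem natDegree_planeRestr_le {x y : ι} (hxy : x ≠ y) {h : MvPolynomial ι A} {N : ℕ}
    (hh : h.IsHomogeneous N) : (planeRestr (A := A) x y h).natDegree ≤ N := by
  classical
  rw [h.as_sum, map_sum]
  refine Polynomial.natDegree_sum_le_of_forall_le _ _ fun μ hμ => ?_
  have hdeg : μ.degree = N := by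
    by_contra hd
    exact (MvPolynomial.mem_support_iff.mp hμ) (hh.coeff_eq_zero hd)
  rw [planeRestr_monomial hxy]
  split_ifs
  · exact (Polynomial.natDegree_C_mul_X_pow_le _ _).trans (hdeg ▸ Finsupp.le_degree y μ)
  · simp

/-- The constant term of the plane restriction of a form of degree `N` is its `x^N`-coefficient
(`P_L(1, 0) = P(e_x)`). [cite: LandsbergManivelRessayre2013, §2.2] -/
theorem coeff_zero_planeRestr {x y : ι} (hxy : x ≠ y) {h : MvPolynomial ι A} {N : ℕ}
    (hh : h.IsHomogeneous N) :
    (planeRestr (A := A) x y h).coeff 0 = MvPolynomial.coeff (Finsupp.single x N) h := by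
  classical
  conv_lhs => rw [h.as_sum]
  rw [map_sum, Polynomial.finsetSum_coeff]
  have key : ∀ μ ∈ h.support, (planeRestr (A := A) x y (monomial μ (coeff μ h))).coeff 0 =
      if μ = Finsupp.single x N then coeff μ h else 0 := by
    intro μ hμ
    have hdeg : μ.degree = N := by
      by_contra hd
      exact (MvPolynomial.mem_support_iff.mp hμ) (hh.coeff_eq_zero hd)
    rw [planeRestr_monomial hxy]
    by_cases hμx : μ = Finsupp.single x N
    · rw [if_pos hμx, if_pos, hμx, Finsupp.single_apply, if_neg hxy, pow_zero, mul_one,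
        Polynomial.coeff_C_zero]
      intro i hix _
      rw [hμx, Finsupp.single_apply, if_neg (Ne.symm hix)]
    · rw [if_neg hμx]
      split_ifs with hcond
      · have hy : μ y ≠ 0 := by
          intro hy0
          apply hμx
          have hsub : μ.support ⊆ {x, y} := by
            intro i hi
            rw [Finset.mem_insert, Finset.mem_singleton]
            by_contra h'
            rw [not_or] at h'
            exact (Finsupp.mem_support_iff.mp hi) (hcond i h'.1 h'.2)
          have hxN : μ x = N := by
            rw [← hdeg, Finsupp.degree_apply,
              Finset.sum_subset hsub (fun i _ hi => Finsupp.notMem_support_iff.mp hi),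
              Finset.sum_pair hxy, hy0, add_zero]
          ext i
          by_cases hix : i = x
          · rw [hix, Finsupp.single_eq_same, hxN]
          · rw [Finsupp.single_apply, if_neg (Ne.symm hix)]
            by_cases hiy : i = y
            · rw [hiy, hy0]
            · exact hcond i hix hiy
        rw [Polynomial.coeff_C_mul, Polynomial.coeff_X_pow, if_neg (fun h0 => hy h0.symm), mul_zero]
      · rw [Polynomial.coeff_zero]
  rw [Finset.sum_congr rfl key, Finset.sum_ite_eq']
  split_ifs with hmem
  · rfl
  · exact (MvPolynomial.notMem_support_iff.mp hmem).symm

omit [Fintype ι] [DecidableEq ι] in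
/-- The plane restriction of a constant. [cite: LandsbergManivelRessayre2013, §2.2] -/
theorem planeRestr_C [Fintype ι] [DecidableEq ι] (x y : ι) (c : A) :
    planeRestr (A := A) x y (MvPolynomial.C c) = Polynomial.C c := by
  rw [MvPolynomial.algHom_C, Polynomial.algebraMap_eq]

end PlaneForms

/-! ### §15 The LMR flag under the Borel subgroup -/

section FlagBorel

open _root_.Literature.NumberTheory.DiophantineGeometry

variable {n : ℕ}

/-- The LMR flag is strictly decreasing. [cite: LandsbergManivelRessayre2013, §2.3] -/
theorem lmrFlag_strictAnti (hn : 3 ≤ n) : StrictAnti (lmrFlag n hn) := fun a b hab => by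
  rw [lmrFlag_apply, lmrFlag_apply]
  exact (matIdxEquiv n).strictMono (Fin.rev_lt_rev.mpr hab)

/-- The image of the LMR flag is an upper set of `MatIdx n`.
[cite: LandsbergManivelRessayre2013, §2.3 ("a basis adapted to `D ⊂ L ⊂ F`")] -/
theorem mem_range_lmrFlag_of_le (hn : 3 ≤ n) {a : Fin (2 * n - 1 + 2)} {j : MatIdx n}
    (h : lmrFlag n hn a ≤ j) : j ∈ Set.range (lmrFlag n hn) := by
  set t : Fin (n * n) := Fin.rev ((matIdxEquiv n).symm j) with ht
  have hj : j = matIdxEquiv n (Fin.rev t) := by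
    rw [ht, Fin.rev_rev, OrderIso.apply_symm_apply]
  have hle : (t : ℕ) ≤ a := by
    have h1 : Fin.rev (Fin.castLE (two_mul_sub_one_add_two_le_sq hn) a) ≤ Fin.rev t := by
      rw [lmrFlag_apply, hj] at h
      exact (matIdxEquiv n).le_iff_le.mp h
    exact Fin.rev_le_rev.mp h1
  refine ⟨⟨t, lt_of_le_of_lt hle a.2⟩, ?_⟩
  rw [lmrFlag_apply, hj]
  congr 1

/-- For an upper-triangular matrix `B`, the rows of `B` indexed by the LMR flag are supported on
the flag (`B` preserves the span `F` of the `2n+1` greatest coordinates).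
[cite: LandsbergManivelRessayre2013, §2.3] -/
theorem mem_range_lmrFlag_of_apply_ne_zero (hn : 3 ≤ n) {A : Type*} [CommRing A]
    {B : Matrix (MatIdx n) (MatIdx n) A} (hB : B.BlockTriangular id) (a : Fin (2 * n - 1 + 2))
    (j : MatIdx n) (h : B (lmrFlag n hn a) j ≠ 0) : j ∈ Set.range (lmrFlag n hn) := by
  apply mem_range_lmrFlag_of_le hn (a := a)
  by_contra hlt
  exact h (hB (not_le.mp hlt))

/-- Row `f 0` (the greatest coordinate) of an upper-triangular `B` is `B₀₀ e_{f 0}`.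
[cite: LandsbergManivelRessayre2013, §2.3, eq. (4)] -/
theorem row_lmrFlag_zero (hn : 3 ≤ n) {A : Type*} [CommRing A]
    {B : Matrix (MatIdx n) (MatIdx n) A} (hB : B.BlockTriangular id) :
    B.row (lmrFlag n hn 0) =
      Pi.single (M := fun _ => A) (lmrFlag n hn 0) (B (lmrFlag n hn 0) (lmrFlag n hn 0)) := by
  funext i
  rw [Matrix.row_apply]
  by_cases hi : i = lmrFlag n hn 0
  · rw [hi, Pi.single_eq_same]
  · rw [Pi.single_eq_of_ne hi]
    by_contra hne
    obtain ⟨b, rfl⟩ := mem_range_lmrFlag_of_apply_ne_zero hn hB 0 i hne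
    have hb : b ≠ 0 := fun h => hi (by rw [h])
    have hlt : lmrFlag n hn b < lmrFlag n hn 0 :=
      lmrFlag_strictAnti hn (Fin.pos_iff_ne_zero.mpr hb)
    exact hne (hB hlt)

/-- Row `f 1` of an upper-triangular `B` is `B₁₀ e_{f 0} + B₁₁ e_{f 1}`.
[cite: LandsbergManivelRessayre2013, §2.3, eq. (4)] -/
theorem row_lmrFlag_one (hn : 3 ≤ n) {A : Type*} [CommRing A]
    {B : Matrix (MatIdx n) (MatIdx n) A} (hB : B.BlockTriangular id) :
    B.row (lmrFlag n hn 1) =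
      Pi.single (M := fun _ => A) (lmrFlag n hn 0) (B (lmrFlag n hn 1) (lmrFlag n hn 0)) +
        Pi.single (M := fun _ => A) (lmrFlag n hn 1) (B (lmrFlag n hn 1) (lmrFlag n hn 1)) := by
  have h01 : lmrFlag n hn 0 ≠ lmrFlag n hn 1 := fun h =>
    absurd (lmrFlag_injective hn h) Fin.zero_ne_one
  funext i
  rw [Matrix.row_apply, Pi.add_apply]
  by_cases hi0 : i = lmrFlag n hn 0
  · rw [hi0, Pi.single_eq_same, Pi.single_eq_of_ne h01, add_zero]
  by_cases hi1 : i = lmrFlag n hn 1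
  · rw [hi1, Pi.single_eq_same, Pi.single_eq_of_ne (Ne.symm h01), zero_add]
  rw [Pi.single_eq_of_ne hi0, Pi.single_eq_of_ne hi1, add_zero]
  by_contra hne
  obtain ⟨b, rfl⟩ := mem_range_lmrFlag_of_apply_ne_zero hn hB 1 i hne
  have hb : 1 < b := by
    rcases lt_trichotomy 1 b with h | h | h
    · exact h
    · exact absurd h.symm (fun h' => hi1 (by rw [h']))
    · have : b = 0 := by
        have : (b : ℕ) < 1 := h
        exact Fin.ext (by simpa using this)
      exact absurd this (fun h' => hi0 (by rw [h']))
  exact hne (hB (lmrFlag_strictAnti hn hb))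

/-- The flag block `B|_{F×F}` of an upper-triangular `B` is lower-triangular in the flag's
(decreasing) enumeration, so its determinant is the product of the diagonal entries.
[cite: LandsbergManivelRessayre2013, §2.3, eq. (5)] -/
theorem det_submatrix_lmrFlag (hn : 3 ≤ n) {A : Type*} [CommRing A]
    {B : Matrix (MatIdx n) (MatIdx n) A} (hB : B.BlockTriangular id) :
    (B.submatrix (lmrFlag n hn) (lmrFlag n hn)).det = ∏ a, B (lmrFlag n hn a) (lmrFlag n hn a) := by
  rw [Matrix.det_of_lowerTriangular]
  · rfl
  · intro a b hab
    exact hB (lmrFlag_strictAnti hn hab)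

end FlagBorel

/-! ### §16 LMR's equation of the flag under an upper-triangular substitution -/

section BorelAction

open _root_.Literature.NumberTheory.DiophantineGeometry

variable {K : Type*} [Field K] {n : ℕ}

/-- `(2n+1)(n−2) = M + n − 1` for `M = lmrDegM n`, `n ≥ 3` (`e = M + d − 1`).
[cite: LandsbergManivelRessayre2013, §2.3 (`b = e − d + 1`)] -/
theorem flag_card_mul_eq (hn : 3 ≤ n) : (2 * n - 1 + 2) * (n - 2) = lmrDegM n + n - 1 := by
  obtain ⟨j, rfl⟩ := Nat.exists_eq_add_of_le' hn
  rw [lmrDegM]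
  have h1 : 2 * (j + 3) - 1 + 2 = 2 * (j + 3) + 1 := by omega
  have h2 : j + 3 - 2 = j + 1 := by omega
  rw [h1, h2]
  have h3 : j + 3 ≤ (2 * (j + 3) + 1) * (j + 1) := by nlinarith
  generalize (2 * (j + 3) + 1) * (j + 1) = t at h3 ⊢
  omega

/-- **The equation of the flag transforms by a character under the Borel subgroup** (on the
dense set `P(e_x) ≠ 0`): for `B` upper-triangular and a form `h` of degree `n` with
`h(e_{f 0}) ≠ 0`, `E_f(h ∘ Bᵀ) = det(B|_F)² · B₀₀^{nM+n−1} · B₁₁^{M} · E_f(h)`.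
[cite: LandsbergManivelRessayre2013, §2.3, eqs. (3)–(5)] -/
theorem lmrEq_linSubst_of_blockTriangular (hn : 3 ≤ n) {B : Matrix (MatIdx n) (MatIdx n) K}
    (hB : B.BlockTriangular id) {h : MvPolynomial (MatIdx n) K} (hh : h.IsHomogeneous n)
    (h0 : (planeRestr (A := K) (lmrFlag n hn 0) (lmrFlag n hn 1) h).coeff 0 ≠ 0) :
    lmrEq (lmrFlag n hn) (lmrDegM n) (linSubst (MatIdx n) K B h) =
      (B.submatrix (lmrFlag n hn) (lmrFlag n hn)).det ^ 2 *
        B (lmrFlag n hn 0) (lmrFlag n hn 0) ^ (n * lmrDegM n + (n - 1)) *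
        B (lmrFlag n hn 1) (lmrFlag n hn 1) ^ lmrDegM n *
        lmrEq (lmrFlag n hn) (lmrDegM n) h := by
  set f := lmrFlag n hn with hf
  set α := B (f 0) (f 0) with hα
  set β := B (f 1) (f 1) with hβ
  set γ := B (f 1) (f 0) with hγ
  have hxy : f 0 ≠ f 1 := fun h => absurd (lmrFlag_injective hn h) Fin.zero_ne_one
  -- plane restrictions after the substitution are lmrTwists
  have htw : ∀ {Q : MvPolynomial (MatIdx n) K} {N : ℕ}, Q.IsHomogeneous N →
      planeRestr (A := K) (f 0) (f 1) (linSubst (MatIdx n) K B Q) =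
        lmrTwist N α β γ (planeRestr (A := K) (f 0) (f 1) Q) := by
    intro Q N hQ
    change lineRestr _ _ (linSubst (MatIdx n) K B Q) = _
    rw [lineRestr_linSubst, Matrix.single_one_vecMul, Matrix.single_one_vecMul,
      row_lmrFlag_zero hn hB, row_lmrFlag_one hn hB, lineRestr_single_eq_lmrTwist hxy α β γ hQ]
  -- the Hessian minor after the substitution
  have hsel : selMatrix (A := K) f * B = B.submatrix f f * selMatrix (A := K) f :=
    selMatrix_mul_eq_submatrix_mul f (lmrFlag_injective hn) B
      (fun a j hne => mem_range_lmrFlag_of_apply_ne_zero hn hB a j hne)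
  have hQhom : (hessGenMinor (selMatrix (A := K) f) (selMatrix (A := K) f) h).IsHomogeneous
      ((2 * n - 1 + 2) * (n - 2)) := isHomogeneous_hessGenMinor _ _ hh
  have hQ : planeRestr (A := K) (f 0) (f 1)
      (hessGenMinor (selMatrix (A := K) f) (selMatrix (A := K) f) (linSubst (MatIdx n) K B h)) =
      Polynomial.C ((B.submatrix f f).det ^ 2) *
        lmrTwist ((2 * n - 1 + 2) * (n - 2)) α β γ (planeRestr (A := K) (f 0) (f 1)
          (hessGenMinor (selMatrix (A := K) f) (selMatrix (A := K) f) h)) := by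
    rw [hessGenMinor_linSubst, hsel, hessGenMinor_mul_mul, map_mul, linSubst_C, map_mul,
      planeRestr_C, htw hQhom, pow_two]
  -- degrees and the lmrTwist identity
  have hM1 : 1 ≤ lmrDegM n := by
    rw [lmrDegM_eq hn]; omega
  have hp : (planeRestr (A := K) (f 0) (f 1) h).natDegree ≤ n := natDegree_planeRestr_le hxy hh
  have hq : (planeRestr (A := K) (f 0) (f 1)
      (hessGenMinor (selMatrix (A := K) f) (selMatrix (A := K) f) h)).natDegree ≤
      lmrDegM n + n - 1 := flag_card_mul_eq hn ▸ natDegree_planeRestr_le hxy hQhom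
  rw [lmrEq, lmrEq, htw hh, hQ, lmrR_C_mul_right, flag_card_mul_eq hn,
    lmrR_lmrTwist hM1 (by omega) hp hq h0]
  ring

end BorelAction


/-! ### §17 The weight: `λ(n)^*` on the Borel subgroup -/

section Weights

open _root_.Literature.NumberTheory.DiophantineGeometry _root_.Literature.Computability.Complexity

variable {n : ℕ}

/-- `λ₁ = 2n³ − 4n² + 1 = nM + (n − 1) + 2` with `M = lmrDegM n`.
[cite: LandsbergManivelRessayre2013, §2.3 (`a + b + c = 2 + e + (d−1)(e−d+1)`)] -/
theorem lmrParts_fst_eq (hn : 3 ≤ n) : 2 * n ^ 3 - 4 * n ^ 2 + 1 = n * lmrDegM n + (n - 1) + 2 := by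
  rw [lmrDegM_eq hn]
  obtain ⟨j, rfl⟩ := Nat.exists_eq_add_of_le' hn
  have h1 : 4 * (j + 3) ^ 2 ≤ 2 * (j + 3) ^ 3 := by nlinarith
  have h2 : 5 ≤ 2 * (j + 3) := by omega
  have h3 : 1 ≤ j + 3 := by omega
  zify [h1, h2, h3]
  ring

/-- `λ₂ = 2n² − 4n + 1 = M + 2`. [cite: LandsbergManivelRessayre2013, §2.3 (`b + c = e − d + 3`)] -/
theorem lmrParts_snd_eq (hn : 3 ≤ n) : 2 * n ^ 2 - 4 * n + 1 = lmrDegM n + 2 := by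
  rw [lmrDegM_eq hn]
  obtain ⟨j, rfl⟩ := Nat.exists_eq_add_of_le' hn
  have h1 : 4 * (j + 3) ≤ 2 * (j + 3) ^ 2 := by nlinarith
  have h2 : 5 ≤ 2 * (j + 3) := by omega
  have h3 : 1 ≤ j + 3 := by omega
  zify [h1, h2, h3]
  ring

/-- The sorted parts of `λ(n)`: `[λ₁, λ₂, 2, …, 2]`. [cite: LandsbergManivelRessayre2013,
Thm. 1.1.2 (1) (p. 470)] -/
theorem sortedParts_lmrPartition (hn : 3 ≤ n) :
    (lmrPartition n).sortedParts =
      (2 * n ^ 3 - 4 * n ^ 2 + 1) :: (2 * n ^ 2 - 4 * n + 1) :: List.replicate (2 * n - 1) 2 := by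
  have h2 : 2 ≤ n := by omega
  have hab : 2 * n ^ 2 - 4 * n + 1 ≤ 2 * n ^ 3 - 4 * n ^ 2 + 1 := by
    rw [lmrParts_fst_eq hn, lmrParts_snd_eq hn]
    nlinarith
  have hb2 : 2 ≤ 2 * n ^ 2 - 4 * n + 1 := by
    rw [lmrParts_snd_eq hn]; omega
  rw [Nat.Partition.sortedParts, lmrPartition_parts h2, lmrParts,
    show ((2 * n ^ 3 - 4 * n ^ 2 + 1) ::ₘ (2 * n ^ 2 - 4 * n + 1) ::ₘ Multiset.replicate (2 * n - 1) 2
      : Multiset ℕ) = (((2 * n ^ 3 - 4 * n ^ 2 + 1) :: (2 * n ^ 2 - 4 * n + 1) ::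
        List.replicate (2 * n - 1) 2 : List ℕ) : Multiset ℕ) by
      rw [← Multiset.coe_replicate, ← Multiset.cons_coe, ← Multiset.cons_coe],
    Multiset.coe_sort]
  apply List.mergeSort_eq_self
  refine List.pairwise_cons.mpr ⟨fun z hz => ?_, List.pairwise_cons.mpr ⟨fun z hz => ?_, ?_⟩⟩
  · rcases List.mem_cons.mp hz with rfl | hz'
    · exact hab
    · rw [List.eq_of_mem_replicate hz']; exact hb2.trans hab
  · rw [List.eq_of_mem_replicate hz]; exact hb2
  · exact List.pairwise_replicate.mpr (Or.inr le_rfl)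

/-- The weight `λ(n)^*` along the LMR flag: `χ(f a) = −λ_{a+1}`, and `χ = 0` off the flag; as a
consequence, on an upper-triangular `g` with `B = g⁻¹`,
`χ(g) = det(B|_F)² · B₀₀^{nM+n−1} · B₁₁^{M}`. [cite: LandsbergManivelRessayre2013, §2.3
(exponent vector `(a+b+c, b+c, c^{(k+1)})`)] -/
theorem weightChar_lmrPartition (hn : 3 ≤ n) {g : GL (MatIdx n) ℂ} (hg : IsUpperTriangular g) :
    weightChar (partitionWeightLex n (lmrPartition n)) g =
      (((g⁻¹ : GL (MatIdx n) ℂ) : Matrix (MatIdx n) (MatIdx n) ℂ).submatrix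
          (lmrFlag n hn) (lmrFlag n hn)).det ^ 2 *
        ((g⁻¹ : GL (MatIdx n) ℂ) : Matrix (MatIdx n) (MatIdx n) ℂ) (lmrFlag n hn 0) (lmrFlag n hn 0) ^
          (n * lmrDegM n + (n - 1)) *
        ((g⁻¹ : GL (MatIdx n) ℂ) : Matrix (MatIdx n) (MatIdx n) ℂ) (lmrFlag n hn 1) (lmrFlag n hn 1) ^
          lmrDegM n := by
  set χ := partitionWeightLex n (lmrPartition n) with hχ
  set B : Matrix (MatIdx n) (MatIdx n) ℂ := ((g⁻¹ : GL (MatIdx n) ℂ) : Matrix (MatIdx n) (MatIdx n) ℂ)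
    with hBdef
  set f := lmrFlag n hn with hf
  set L : List ℕ := (lmrPartition n).sortedParts with hL
  have hg' : IsUpperTriangular g⁻¹ := (borelSubgroup (MatIdx n) ℂ).inv_mem hg
  have hB : B.BlockTriangular id := hg'
  -- (W1) χ(g) = χ(g⁻¹)⁻¹
  have h1 : weightChar χ g * weightChar χ g⁻¹ = 1 := by
    rw [← weightChar_mul χ hg hg', mul_inv_cancel, weightChar_one]
  rw [eq_inv_of_mul_eq_one_left h1]
  -- (W2–W5) χ(g⁻¹) = (∏_j d_j ^ L_j)⁻¹ over j : Fin (n*n), d_j = B (revMatIdx n j) (revMatIdx n j)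
  have hval : ∀ j : Fin (n * n), χ (revMatIdx n j) = -((L.getD j 0 : ℕ) : ℤ) := by
    intro j
    have := neg_partitionWeightLex_revMatIdx n (lmrPartition n) j
    rw [← hχ] at this
    rw [← neg_neg (χ (revMatIdx n j)), this]
    rfl
  have h2 : weightChar χ g⁻¹ = (∏ j : Fin (n * n), B (revMatIdx n j) (revMatIdx n j) ^ L.getD j 0)⁻¹ := by
    rw [weightChar, ← Finset.prod_inv_distrib]
    refine (Fintype.prod_equiv (revMatIdx n) _ _ fun j => ?_).symm
    rw [hval, _root_.zpow_neg, zpow_natCast]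
  rw [h2, inv_inv]
  -- (W6) restrict to the flag
  have hlen : L.length = 2 * n - 1 + 2 := by
    rw [hL, sortedParts_lmrPartition hn, List.length_cons, List.length_cons, List.length_replicate]
  have h3 : ∏ j : Fin (n * n), B (revMatIdx n j) (revMatIdx n j) ^ L.getD j 0 =
      ∏ a : Fin (2 * n - 1 + 2), B (f a) (f a) ^ L.getD a 0 := by
    have step : ∏ a : Fin (2 * n - 1 + 2), B (f a) (f a) ^ L.getD a 0 =
        ∏ j ∈ (Finset.univ : Finset (Fin (2 * n - 1 + 2))).map
          (Fin.castLEEmb (two_mul_sub_one_add_two_le_sq hn)),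
          B (revMatIdx n j) (revMatIdx n j) ^ L.getD j 0 := by
      rw [Finset.prod_map]
      rfl
    rw [step]
    refine (Finset.prod_subset (Finset.subset_univ _) fun j _ hj => ?_).symm
    have hjl : L.length ≤ j := by
      rw [hlen]
      by_contra hlt
      apply hj
      rw [Finset.mem_map]
      exact ⟨⟨j, not_le.mp hlt⟩, Finset.mem_univ _, Fin.ext rfl⟩
    rw [List.getD_eq_default _ _ hjl, pow_zero]
  rw [h3, det_submatrix_lmrFlag hn hB]
  -- (W7–W8) both sides as products over the flag, split off a = 0, 1
  rw [Fin.prod_univ_succ, Fin.prod_univ_succ, Fin.prod_univ_succ, Fin.prod_univ_succ]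
  have hL0 : L.getD ((0 : Fin (2 * n - 1 + 2)) : ℕ) 0 = n * lmrDegM n + (n - 1) + 2 := by
    rw [hL, sortedParts_lmrPartition hn, Fin.val_zero, List.getD_cons_zero, lmrParts_fst_eq hn]
  have hL1 : L.getD ((Fin.succ (0 : Fin (2 * n - 1 + 1))) : ℕ) 0 = lmrDegM n + 2 := by
    rw [hL, sortedParts_lmrPartition hn, Fin.val_succ, Fin.val_zero, List.getD_cons_succ,
      List.getD_cons_zero, lmrParts_snd_eq hn]
  have hL2 : ∀ c : Fin (2 * n - 1), L.getD ((c.succ.succ : Fin (2 * n - 1 + 2)) : ℕ) 0 = 2 := by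
    intro c
    rw [hL, sortedParts_lmrPartition hn, Fin.val_succ, Fin.val_succ, List.getD_cons_succ,
      List.getD_cons_succ, List.getD_replicate _ c.2]
  rw [hL0, hL1]
  simp only [hL2, Finset.prod_pow, hf, Fin.succ_zero_eq_one]
  ring

end Weights

/-! ### §18 The highest-weight vector and the discharge of `LMR2013_thm_1_1_2_1` -/

section Discharge

open _root_.Literature.NumberTheory.DiophantineGeometry _root_.Literature.Computability.Complexity

variable {σ : Type*} [Fintype σ] [DecidableEq σ] {k : Type*} [Field k]

variable {n : ℕ}

/-- **LMR's equation of the flag of the `2n+1` greatest coordinates is a highest-weight vector of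
weight `λ(n)^*`.** [cite: LandsbergManivelRessayre2013, §2.3 ("This equation must therefore be a
highest weight vector … its highest weight must be of the form `aω_1 + bω_2 + cω_{k+3}`") with
Thm. 2.3.1 (p. 474)] -/
theorem lmrEqCoord_lmrFlag_mem_highestWeightSpace (hn : 3 ≤ n) :
    lmrEqCoord (k := ℂ) (lmrFlag n hn) (lmrDegM n) n ∈
      highestWeightSpace (coordRep (MatIdx n) ℂ n) (partitionWeightLex n (lmrPartition n)) := by
  rw [mem_highestWeightSpace_iff]
  intro g hg
  rw [coordRep_apply]
  set F := lmrEqCoord (k := ℂ) (lmrFlag n hn) (lmrDegM n) n with hF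
  set c := weightChar (partitionWeightLex n (lmrPartition n)) g with hc
  set B : Matrix (MatIdx n) (MatIdx n) ℂ := ((g⁻¹ : GL (MatIdx n) ℂ) : Matrix (MatIdx n) (MatIdx n) ℂ)
    with hBdef
  have hg' : IsUpperTriangular g⁻¹ := (borelSubgroup (MatIdx n) ℂ).inv_mem hg
  have hB : B.BlockTriangular id := hg'
  have hxy : lmrFlag n hn 0 ≠ lmrFlag n hn 1 := fun h =>
    absurd (lmrFlag_injective hn h) Fin.zero_ne_one
  -- the monomial `x^n` of the top coordinate, as a coordinate of `Sym^n`
  let δ₀ : DegIdx (MatIdx n) n :=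
    ⟨Finsupp.single (lmrFlag n hn 0) n, mem_degMonomials_iff.mpr (Finsupp.degree_single _ _)⟩
  -- evaluation identity on the dense set `v δ₀ ≠ 0`
  have hev : ∀ v : DegIdx (MatIdx n) n → ℂ, v δ₀ ≠ 0 →
      MvPolynomial.eval v (coordSubst n g F) = MvPolynomial.eval v (c • F) := by
    intro v hv
    set h : MvPolynomial (MatIdx n) ℂ := ∑ δ : DegIdx (MatIdx n) n, monomial δ.1 (v δ) with hh
    have hhom : h.IsHomogeneous n := isHomogeneous_sum_monomial v
    have hfc : formCoeff n h = v := formCoeff_sum_monomial v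
    have hL : MvPolynomial.eval v (coordSubst n g F) =
        lmrEq (lmrFlag n hn) (lmrDegM n) (linSubst (MatIdx n) ℂ B h) := by
      have e1 : MvPolynomial.eval v (coordSubst n g F) =
          MvPolynomial.aeval (formCoeff n h) (coordSubst n g F) := by
        rw [hfc]
        rfl
      rw [e1, aeval_formCoeff_coordSubst, linSubstRep_apply,
        aeval_formCoeff_lmrEqCoord _ _ (linSubst_isHomogeneous _ hhom)]
    have hR : MvPolynomial.eval v (c • F) = c * lmrEq (lmrFlag n hn) (lmrDegM n) h := by
      rw [MvPolynomial.smul_eq_C_mul, map_mul, MvPolynomial.eval_C, hF, eval_lmrEqCoord]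
    have h0 : (planeRestr (A := ℂ) (lmrFlag n hn 0) (lmrFlag n hn 1) h).coeff 0 ≠ 0 := by
      rw [coeff_zero_planeRestr hxy hhom]
      have : MvPolynomial.coeff (Finsupp.single (lmrFlag n hn 0) n) h = formCoeff n h δ₀ := rfl
      rwa [this, hfc]
    rw [hL, hR, lmrEq_linSubst_of_blockTriangular hn hB hhom h0, hc, weightChar_lmrPartition hn hg]
  -- density: `(g·F − c F) · X_{δ₀}` vanishes identically
  have hΦ : (coordSubst n g F - c • F) * X δ₀ = 0 := by
    apply MvPolynomial.funext
    intro v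
    rw [map_mul, MvPolynomial.eval_X, map_zero]
    by_cases hv : v δ₀ = 0
    · rw [hv, mul_zero]
    · rw [map_sub, hev v hv, sub_self, zero_mul]
  have hzero : coordSubst n g F - c • F = 0 :=
    (mul_eq_zero.mp hΦ).resolve_right (X_ne_zero δ₀)
  exact sub_eq_zero.mp hzero

/-- **Discharge of `LMR2013_thm_1_1_2_1`** (Landsberg–Manivel–Ressayre 2013, Thm. 1.1.2 (1) with
§3.2, for every `n ≥ 3`): LMR's equation `E_f` of the flag of the `2n+1` greatest coordinates is a
nonzero highest-weight vector of weight `λ(n)^* = (2n³−4n²+1, 2n²−4n+1, 2^{2n−1})^*` of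
`ℂ[Sym^n(ℂ^{n×n})]` lying in the ideal of `GL_{n²}·det_n`.
[cite: LandsbergManivelRessayre2013, Thm. 1.1.2 (1) (p. 470), §2.3 and Thm. 2.3.1 (p. 474), §3.1–3.2 (p. 476)] -/
theorem LMR2013_thm_1_1_2_1_holds : LMR2013_thm_1_1_2_1 := by
  intro n _ hn
  haveI : Infinite ℂ := CharZero.infinite ℂ
  set f := lmrFlag n hn with hf
  refine ⟨lmrEqCoord (k := ℂ) f (lmrDegM n) n, ?_, lmrEqCoord_lmrFlag_mem_highestWeightSpace hn, ?_⟩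
  · -- nonzero: the test form
    have hcons : (Fin.cons (f 0) (Fin.cons (f 1) (fun c => f c.succ.succ) :
        Fin (2 * n - 1 + 1) → MatIdx n) : Fin (2 * n - 1 + 2) → MatIdx n) = f := by
      funext a
      cases a using Fin.cases with
      | zero => rfl
      | succ a' =>
        cases a' using Fin.cases with
        | zero => rfl
        | succ c => rfl
    have hinj : Function.Injective (Fin.cons (f 0) (Fin.cons (f 1) (fun c => f c.succ.succ) :
        Fin (2 * n - 1 + 1) → MatIdx n) : Fin (2 * n - 1 + 2) → MatIdx n) := by
      rw [hcons]
      exact lmrFlag_injective hn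
    have hE := lmrEq_lmrWitness_ne_zero (k := ℂ) hn hinj
    rw [hcons] at hE
    exact lmrEqCoord_ne_zero (k := ℂ) f (lmrDegM n) (lmrWitness_isHomogeneous (k := ℂ) hn _ _ _) hE
  · exact lmrEqCoord_mem_orbitVanishingIdeal (k := ℂ) f (lmrDegM n) (detFormLex_isHomogeneous ℂ n)
      (fun P hP => lmrEq_eq_zero_of_mem_glOrbit_detFormLex hn f hP)

end Discharge

end Literature.Computability.AlgebraicComplexity
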